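import Mathlib
import HarnessLib
import Summits.MatrixMultiplication.MatrixMultiplication.Theorems.FarEdgeDescentFloorDial
import Summits.MatrixMultiplication.MatrixMultiplication.Theorems.FarEdgeDescentPinnedSchedules
import Summits.MatrixMultiplication.MatrixMultiplication.Theorems.FarEdgeDescentPotentialCap
import Summits.MatrixMultiplication.MatrixMultiplication.Theorems.FarEdgeDescentNarrownessPotential
import Summits.MatrixMultiplication.MatrixMultiplication.Theorems.FarEdgeDescentChainCapSteps

/-!
# Far-edge descent, kernel XLII-D — the floor transfer by Abel summation: `V_z ≥ V_floor` on admissible schedules (model level)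

Kernel XLII-C (`FarEdgeDescentNarrownessPotential`) reduced the schedule cap XL-D for a dial `(a, β)`
to two hypotheses: the numerically certified `RegionCriterion β z ε Vmin κ` and the FLOOR TRANSFER
`FloorTransfer a β z Vmin` — every admissible schedule has narrowness `V_z ≥ Vmin`.  THIS FILE proves
the floor transfer, for the truncated exact floor minimum
`Vfloor a β z m = 1 − (1−z)·Σ_{k<m} τ'_{k+2} z^k − τ'_{m+2}·z^m`,  `τ'_j = min(1, β/(2 − a^{−j}))`
(`tauP`), for EVERY `m`, every `2 ≤ a`, `1 ≤ β`, `0 < z ≤ 1` (`floorTransfer`).  As `m → ∞`,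
`Vfloor ↑ 1 − (1−z)Σ_{e≥2} τ'_e z^{e−2} = Vmin_exact(β, z)` of memo g62 §3 (the exact minimum of
`V_z` over the floor polytope), geometrically (`Vfloor_mono`: the sequence is nondecreasing).

THE ARGUMENT is Abel summation (`abel`): with `T_j` the leg mass at widths `≥ a^j` (`tailMass`),
`c_e = T_e − T_{e+1}` and `T_0 = T_1 = L`, so
`p(z) = Σ_e c_e z^e = z·L − z·[(1−z)·Σ_{k<m} T_{k+2} z^k + T_{m+2} z^m]`  (`eval_abel`, degree `< m+2`),
and the floors `(2 − a^{−j})·T_j ≤ β·L` of XXXIX-G (`FloorOK`, every `j ≥ 1`) together with `T_j ≤ L`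
give `T_j ≤ τ'_j·L` (`tailMass_le`), whence `p(z) ≥ z·L·Vfloor(m)`; smaller `m` only weakens the bound.
COROLLARY (`capXLD_of_regionCriterion_floor`): for `3/2 ≤ β ≤ 2`, `9/10 ≤ z ≤ 1`, `0 < ε`, and ANY
`m`, `RegionCriterion β z ε (Vfloor a β z m) κ_S` ALONE implies the conclusion of XL-D for the dial
`(a, β)` — the cap conjecture per dial is reduced to ONE real inequality in five variables, certified
numerically in memo g62 §3/§5 (`z = 99/100`, `ε = 1/100`: worst ratio `< 1` at every sampled
`β ∈ [3/2, 1.9999]`; NOT a proof).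

HONEST FRAMING: MODEL level; no `sorry`, no new axioms; definitions `tauP`, `Vfloor` only.  Nothing
here touches `_root_.MatrixMultiplication` or the `closes` cut.  References: Schönhage 1981
[Schonhage1981]; kernels XXXIX-G, XL-A, XLI-A, XLII-A/B/C; memo g62.
-/

noncomputable section

set_option linter.dupNamespace false

namespace Summit.MatrixMultiplication.MatrixMultiplication.Theorems.FarEdgeDescentFloorNarrowness

open Polynomial Finset
open Summit.MatrixMultiplication.MatrixMultiplication.Theorems.FarEdgeDescentFloorDial
open Summit.MatrixMultiplication.MatrixMultiplication.Theorems.FarEdgeDescentFloorDial.Sched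
open Summit.MatrixMultiplication.MatrixMultiplication.Theorems.FarEdgeDescentPinnedSchedules
open Summit.MatrixMultiplication.MatrixMultiplication.Theorems.FarEdgeDescentPotentialCap
open Summit.MatrixMultiplication.MatrixMultiplication.Theorems.FarEdgeDescentNarrownessPotential
open Summit.MatrixMultiplication.MatrixMultiplication.Theorems.FarEdgeDescentChainCapSteps

/-! ## The floor weights and the truncated floor minimum -/

/-- Floor weight at depth `j`: `τ'_j = min(1, β/(2 − a^{−j}))` (the floor of XXXIX-G says
`T_j ≤ τ'_j·L`). -/
def tauP (a β : ℝ) (j : ℕ) : ℝ := min 1 (β / (2 - a⁻¹ ^ j))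

/-- Truncated floor minimum of the narrowness at scale `z`:
`Vfloor(m) = 1 − (1−z)·Σ_{k<m} τ'_{k+2} z^k − τ'_{m+2} z^m`. -/
def Vfloor (a β z : ℝ) (m : ℕ) : ℝ :=
  1 - (1 - z) * ∑ k ∈ range m, tauP a β (k + 2) * z ^ k - tauP a β (m + 2) * z ^ m

/-- The floor denominators are at least `1` when `a ≥ 2`. -/
theorem floorDen_ge_one {a : ℝ} (ha : 2 ≤ a) (j : ℕ) : 1 ≤ 2 - a⁻¹ ^ j := by
  have ha0 : 0 < a := by linarith
  have hi0 : 0 ≤ a⁻¹ := inv_nonneg.mpr ha0.le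
  have hi1 : a⁻¹ ≤ 1 := by rw [inv_eq_one_div, div_le_one ha0]; linarith
  have : a⁻¹ ^ j ≤ 1 := pow_le_one₀ hi0 hi1
  linarith

/-- The floor weights are nonincreasing in the depth (`β ≥ 0`, `a ≥ 2`). -/
theorem tauP_succ_le {a β : ℝ} (ha : 2 ≤ a) (hβ : 0 ≤ β) (j : ℕ) :
    tauP a β (j + 1) ≤ tauP a β j := by
  have ha0 : 0 < a := by linarith
  have hi0 : 0 ≤ a⁻¹ := inv_nonneg.mpr ha0.le
  have hi1 : a⁻¹ ≤ 1 := by rw [inv_eq_one_div, div_le_one ha0]; linarith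
  have hpow : a⁻¹ ^ (j + 1) ≤ a⁻¹ ^ j := by
    rw [pow_succ]
    exact mul_le_of_le_one_right (pow_nonneg hi0 j) hi1
  have hD : 0 < 2 - a⁻¹ ^ j := by linarith [floorDen_ge_one ha j]
  unfold tauP
  apply min_le_min le_rfl
  exact div_le_div_of_nonneg_left hβ hD (by linarith)

/-- `Vfloor` is nondecreasing in the truncation depth. -/
theorem Vfloor_mono {a β z : ℝ} (ha : 2 ≤ a) (hβ : 0 ≤ β) (hz0 : 0 ≤ z) (m : ℕ) :
    Vfloor a β z m ≤ Vfloor a β z (m + 1) := by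
  unfold Vfloor
  rw [sum_range_succ, pow_succ]
  have h := tauP_succ_le ha hβ (m + 2)
  have hzm : 0 ≤ z ^ m * z := mul_nonneg (pow_nonneg hz0 m) hz0
  have : tauP a β (m + 3) * (z ^ m * z) ≤ tauP a β (m + 2) * (z ^ m * z) :=
    mul_le_mul_of_nonneg_right h hzm
  nlinarith [this]

/-- Hence `Vfloor n ≤ Vfloor m` for `n ≤ m`. -/
theorem Vfloor_le_of_le {a β z : ℝ} (ha : 2 ≤ a) (hβ : 0 ≤ β) (hz0 : 0 ≤ z) {n m : ℕ}
    (h : n ≤ m) : Vfloor a β z n ≤ Vfloor a β z m := by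
  induction m with
  | zero =>
      have : n = 0 := Nat.le_zero.mp h
      subst this; exact le_rfl
  | succ m ih =>
      rcases Nat.lt_or_eq_of_le h with hlt | heq
      · exact le_trans (ih (Nat.lt_succ_iff.mp hlt)) (Vfloor_mono ha hβ hz0 m)
      · rw [heq]

/-! ## Abel summation for the tail masses -/

/-- Abel summation: `Σ_{e ≤ m} (T_e − T_{e+1}) z^e = T_0 − (1−z)Σ_{k<m} T_{k+1} z^k − T_{m+1} z^m`. -/
theorem abel (T : ℕ → ℝ) (z : ℝ) : ∀ m : ℕ,
    ∑ e ∈ range (m + 1), (T e - T (e + 1)) * z ^ e =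
      T 0 - (1 - z) * ∑ k ∈ range m, T (k + 1) * z ^ k - T (m + 1) * z ^ m
  | 0 => by simp
  | m + 1 => by
      rw [sum_range_succ, abel T z m, sum_range_succ, pow_succ]
      ring

/-- Consecutive tail masses differ by a coefficient: `T_e − T_{e+1} = c_e`. -/
theorem tailMass_sub (β : ℝ) (s : Sched) (e : ℕ) :
    tailMass β s e - tailMass β s (e + 1) = (profile β s).coeff e := by
  unfold tailMass
  rw [sum_range_succ]
  ring

/-- `T_0 = L`. -/
theorem tailMass_zero (β : ℝ) (s : Sched) : tailMass β s 0 = legMass β s := by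
  simp [tailMass]

/-- `T_1 = L` when the profile has no constant term. -/
theorem tailMass_one {β : ℝ} {s : Sched} (h0 : (profile β s).coeff 0 = 0) :
    tailMass β s 1 = legMass β s := by
  simp [tailMass, h0]

/-- **The transform by Abel summation.**  If `deg p < m + 2` and `c_0 = 0` then
`p(z) = z·L − z·((1−z)·Σ_{k<m} T_{k+2} z^k + T_{m+2} z^m)`. -/
theorem eval_abel {β : ℝ} (z : ℝ) {s : Sched} (m : ℕ) (hm : (profile β s).natDegree < m + 2)
    (h0 : (profile β s).coeff 0 = 0) :
    (profile β s).eval z = z * legMass β s -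
      z * ((1 - z) * ∑ k ∈ range m, tailMass β s (k + 2) * z ^ k +
        tailMass β s (m + 2) * z ^ m) := by
  rw [eval_eq_sum_range' hm]
  have hc : ∀ i ∈ range (m + 2), (profile β s).coeff i * z ^ i =
      (tailMass β s i - tailMass β s (i + 1)) * z ^ i := by
    intro i _; rw [tailMass_sub]
  rw [sum_congr rfl hc, abel (tailMass β s) z (m + 1), tailMass_zero, sum_range_succ', tailMass_one h0,
    pow_zero, mul_one]
  have e : ∑ k ∈ range m, tailMass β s (k + 1 + 1) * z ^ (k + 1) =
      z * ∑ k ∈ range m, tailMass β s (k + 2) * z ^ k := by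
    rw [mul_sum]
    apply sum_congr rfl
    intro k _
    rw [pow_succ]; ring
  rw [e, pow_succ]
  ring

/-! ## The floors bound the tail masses -/

/-- Admissible schedules pass the node floors. -/
theorem floorOK_of_admissible {a β : ℝ} : ∀ s : Sched, Admissible a β s → FloorOK a β s
  | base _, h => h.2
  | node _ _, h => h.2.2

/-- **Tail-mass bound.**  For an admissible schedule and `j ≥ 1`: `T_j ≤ τ'_j · L`. -/
theorem tailMass_le {a β : ℝ} (ha : 2 ≤ a) (hβ : 1 ≤ β) (s : Sched) (hs : Admissible a β s)
    {j : ℕ} (hj : 1 ≤ j) : tailMass β s j ≤ tauP a β j * legMass β s := by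
  obtain ⟨hnn, _⟩ := profile_coeff hβ s hs
  have hL : 0 < legMass β s := (anchor_legMass hβ s hs).2
  have hD : 0 < 2 - a⁻¹ ^ j := by linarith [floorDen_ge_one ha j]
  have hfl := floorOK_of_admissible s hs j hj
  -- T_j ≤ L
  have h1 : tailMass β s j ≤ 1 * legMass β s := by
    unfold tailMass
    have : 0 ≤ ∑ e ∈ range j, (profile β s).coeff e := sum_nonneg fun e _ => hnn e
    linarith
  -- T_j ≤ β L/(2 − a^{-j})
  have h2 : tailMass β s j ≤ β / (2 - a⁻¹ ^ j) * legMass β s := by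
    rw [div_mul_eq_mul_div, le_div_iff₀ hD]
    linarith [hfl]
  unfold tauP
  rw [min_mul_of_nonneg _ _ hL.le]
  exact le_min h1 h2

/-! ## The floor transfer -/

set_option maxHeartbeats 400000 in
/-- **Floor transfer at truncation depth `m ≥ deg`.** -/
theorem Vfloor_le_narrow_of_degree {a β z : ℝ} (ha : 2 ≤ a) (hβ : 1 ≤ β) (hz0 : 0 < z)
    (hz1 : z ≤ 1) (s : Sched) (hs : Admissible a β s) (m : ℕ)
    (hm : (profile β s).natDegree < m + 2) : Vfloor a β z m ≤ narrow β z s := by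
  obtain ⟨_, h0⟩ := profile_coeff hβ s hs
  have hL : 0 < legMass β s := (anchor_legMass hβ s hs).2
  have hzL : 0 < z * legMass β s := mul_pos hz0 hL
  unfold narrow
  rw [le_div_iff₀ hzL, eval_abel z m hm h0]
  -- termwise bounds
  have hsum : ∑ k ∈ range m, tailMass β s (k + 2) * z ^ k ≤
      ∑ k ∈ range m, tauP a β (k + 2) * legMass β s * z ^ k := by
    apply sum_le_sum
    intro k _
    exact mul_le_mul_of_nonneg_right (tailMass_le ha hβ s hs (by omega)) (pow_nonneg hz0.le k)
  have hlast : tailMass β s (m + 2) * z ^ m ≤ tauP a β (m + 2) * legMass β s * z ^ m :=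
    mul_le_mul_of_nonneg_right (tailMass_le ha hβ s hs (by omega)) (pow_nonneg hz0.le m)
  have h1z : 0 ≤ 1 - z := by linarith
  have hA := mul_le_mul_of_nonneg_left hsum h1z
  have hB : z * ((1 - z) * ∑ k ∈ range m, tailMass β s (k + 2) * z ^ k +
      tailMass β s (m + 2) * z ^ m) ≤
      z * ((1 - z) * ∑ k ∈ range m, tauP a β (k + 2) * legMass β s * z ^ k +
        tauP a β (m + 2) * legMass β s * z ^ m) :=
    mul_le_mul_of_nonneg_left (by linarith) hz0.le
  have e : Vfloor a β z m * (z * legMass β s) = z * legMass β s -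
      z * ((1 - z) * ∑ k ∈ range m, tauP a β (k + 2) * legMass β s * z ^ k +
        tauP a β (m + 2) * legMass β s * z ^ m) := by
    unfold Vfloor
    rw [mul_sum, mul_sum]
    have : ∑ i ∈ range m, (1 - z) * (tauP a β (i + 2) * legMass β s * z ^ i) =
        legMass β s * ∑ i ∈ range m, (1 - z) * (tauP a β (i + 2) * z ^ i) := by
      rw [mul_sum]; apply sum_congr rfl; intro i _; ring
    rw [this]
    ring
  rw [e]
  linarith

/-- **Floor transfer** (`FloorTransfer a β z (Vfloor a β z n)` for every `n`): every admissible
schedule of the dial `(a, β)`, `2 ≤ a`, `1 ≤ β`, has narrowness `V_z ≥ Vfloor(n)` at every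
`0 < z ≤ 1`. -/
theorem floorTransfer {a β z : ℝ} (ha : 2 ≤ a) (hβ : 1 ≤ β) (hz0 : 0 < z) (hz1 : z ≤ 1) (n : ℕ) :
    FloorTransfer a β z (Vfloor a β z n) := by
  intro s hs
  set m := n + (profile β s).natDegree with hm
  have hdeg : (profile β s).natDegree < m + 2 := by omega
  calc Vfloor a β z n ≤ Vfloor a β z m := Vfloor_le_of_le ha (by linarith) hz0.le (by omega)
    _ ≤ narrow β z s := Vfloor_le_narrow_of_degree ha hβ hz0 hz1 s hs m hdeg

/-! ## XL-D per dial from the region criterion alone -/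

/-- **The cap conjecture XL-D for a dial `(a, β)` from ONE real inequality.**  For `2 ≤ a`,
`3/2 ≤ β ≤ 2`, `9/10 ≤ z ≤ 1`, `0 < ε` and any truncation depth `m`: if the region criterion holds
with the floor level `Vfloor a β z m`, then for all `R ≥ 0` and base deviations `0 ≤ y₀ b ≤ R/(b+β)`
ONE constant caps `dev ≤ C·logSize^{κ_S}` over all admissible schedules. -/
theorem capXLD_of_regionCriterion_floor {a β z ε : ℝ} (m : ℕ) (ha : 2 ≤ a) (hβ : 3 / 2 ≤ β)
    (hβ2 : β ≤ 2) (hz : 9 / 10 ≤ z) (hz1 : z ≤ 1) (hε : 0 < ε)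
    (hcrit : RegionCriterion β z ε (Vfloor a β z m) (Real.log (4 / 3) / Real.log 2)) :
    ∀ R : ℝ, 0 ≤ R → ∀ y₀ : ℝ → ℝ, (∀ b : ℝ, 0 ≤ b → 0 ≤ y₀ b ∧ y₀ b ≤ R / (b + β)) →
      ∃ C : ℝ, ∀ s : Sched, Admissible a β s →
        dev β y₀ s ≤ C * logSize β s ^ (Real.log (4 / 3) / Real.log 2) :=
  capXLD_of_regionCriterion' hβ hβ2 hz hz1 hε hcrit
    (floorTransfer ha (by linarith) (by linarith) hz1 m)

end Summit.MatrixMultiplication.MatrixMultiplication.Theorems.FarEdgeDescentFloorNarrowness
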